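import Summits.QuantumFields.BalabanUV.Beta.DiagonalContact
import Summits.QuantumFields.BalabanUV.Beta.FP.ChartConjugationBoundedBricks

/-!
# `BalabanUV.Beta.FP.ChartContactLetters` — road «FP», binder row D1, sub-row **H2-ASM-5a (Kcov)**, module R11: THE LOCALISATION LETTER OF A FIRST-ORDER CHART
# CONTACT WITH A DIAGONAL GENERATOR — `conjV M (diagK g)` is bi-localised at the generator's bond for a DECAYING form `M`, uniformly over a bond-indexed family:
# the R5′ socket's letter `VertexFamily CtVα 1 Cc δ` for chart contacts, with DISPLAYED constant `2·C·Cg` and rate `min η δ`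

HONEST DEPENDENCY (page 1, mandatory): continuum YM on T⁴ ⇐ BetaPertH ∧ nine spine estimates (0/9 proved); BetaPertH ⇐ (D1) ∧ (D4) ∧ CAP+tail;
G-an2-4 gates asym, D1 and NE2/3/4.  HONEST FRAMING (cell contract, verbatim): «discharging `BetaPertH` makes Bałaban's UV stability UNCONDITIONAL —
a real constructive-QFT result; it is NOT the continuum limit and NOT the Clay problem.»  THIS MODULE DISCHARGES NOTHING of the wall: [folklore] one triangle
inequality over an2's `BorderedHessian.conjV_diagK_apply` (entrywise form of the contact); 0 def, 0 `def … : Prop`, nothing cited, 0 sorry; 0∕4 row-D1 binders;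
NOT the (Kcov) instance, NOT H2V-4, NOT D1, NOT BetaPertH, NOT continuum, NOT Clay.  (The slice's own contact letters with sharper support constants are
`SliceContactLetters` p255532; this is the GENERIC letter the total contact `conjV MFˢˢ X` of R10 needs, `MF` decaying by `PerfectPropagatorInverse.decays_MF`.)

ABSOLUTE RULE (cell charter, verbatim): «No internally-minted statement may enter as a cited fact. Every hypothesis is either kernel-proved in this package or a
verbatim quotation of a PUBLISHED theorem with page reference. The manuscript(s) under audit are NOT citable for their own disputed steps — they are the thing
under adjudication; programme-internal (2001/route/tribunal) claims are never citable.»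

CONTENT: `abs_diag_le_of_biLoc`, **`biLoc_conjV_diagK`** (`Decays M C η`, `BiLoc (diagK g) u u Cg δ` ⟹ `BiLoc (conjV M (diagK g)) u u (2·C·Cg) (min η δ)`),
**`vertexFamily_conjV_diagK`** (the family version at blocking `1`).
Provenance: D1 formalisation swarm seat b2b-balaban-beta-d1-formalise-leaf-02 gen 10 (road FP engine lineage; sub-row H2-ASM-5a (Kcov)), 2026-08-21.
-/

noncomputable section

namespace Summit.QuantumFields.BalabanUV.Beta.FP.ChartContactLetters

open Literature.MathematicalPhysics.QuantumFieldTheory.Balaban1983to89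
open Literature.MathematicalPhysics.QuantumFieldTheory.Balaban1983to89.Beta
open B12Sec2to5 (l1 l1_nonneg)
open ExpKernelCalculus (MKer Decays BiLoc VertexFamily l1_sub_triangle)
open OneStepResolventKernel (Fib)
open Summit.QuantumFields.BalabanUV.Beta.ChartConjugation (conjV)
open Summit.QuantumFields.BalabanUV.Beta.BorderedHessian (diagK diagK_apply conjV_diagK_apply)
open Summit.QuantumFields.BalabanUV.Beta.FP.ChartConjugationBoundedBricks (exp_triangle_le)

variable {d : ℕ}

/-- [folklore] the diagonal values of a bi-localised diagonal kernel: `|g x a| ≤ Cg·e^{−2δ|x − u|₁}`. -/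
theorem abs_diag_le_of_biLoc {g : (Fin (d + 1) → ℤ) → Fib d → ℝ} {u : Fin (d + 1) → ℤ} {Cg δ : ℝ} (hg : BiLoc (diagK g) u u Cg δ)
    (x : Fin (d + 1) → ℤ) (a : Fib d) : |g x a| ≤ Cg * Real.exp (-δ * (l1 (x - u) + l1 (x - u))) := by
  have h := hg x x a a
  rwa [diagK_apply, if_pos ⟨rfl, rfl⟩] at h

/-- [folklore] **A FIRST-ORDER CHART CONTACT WITH A DIAGONAL GENERATOR IS BI-LOCALISED AT THE GENERATOR'S BOND**: for `M` decaying at rate `η ≥ 0` with constant `C`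
and `diagK g` bi-localised at `(u, u)` at rate `δ ≥ 0` with constant `Cg`, `conjV M (diagK g)` is bi-localised at `(u, u)` at rate `min η δ` with constant `2·C·Cg`. -/
theorem biLoc_conjV_diagK {M : MKer (d + 1) (Fib d)} {g : (Fin (d + 1) → ℤ) → Fib d → ℝ} {u : Fin (d + 1) → ℤ} {C Cg η δ : ℝ}
    (hM : Decays M C η) (hη : 0 ≤ η) (hg : BiLoc (diagK g) u u Cg δ) (hδ : 0 ≤ δ) :
    BiLoc (conjV M (diagK g)) u u (2 * C * Cg) (min η δ) := by
  intro x z a b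
  rw [conjV_diagK_apply]
  set m : ℝ := min η δ with hm
  have hmη : m ≤ η := min_le_left _ _
  have hmδ : m ≤ δ := min_le_right _ _
  have hm0 : 0 ≤ m := le_min hη hδ
  have hC : 0 ≤ C := hM.nonneg a
  have hCg : 0 ≤ Cg := hg.nonneg a
  have h1 : |M x z a b| ≤ C * Real.exp (-m * l1 (x - z)) := by
    refine (hM x z a b).trans (mul_le_mul_of_nonneg_left (Real.exp_le_exp.mpr ?_) hC)
    nlinarith [l1_nonneg (x - z)]
  have h2 : ∀ y c, |g y c| ≤ Cg * (Real.exp (-m * l1 (y - u)) * Real.exp (-m * l1 (y - u))) := by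
    intro y c
    refine (abs_diag_le_of_biLoc hg y c).trans (mul_le_mul_of_nonneg_left ?_ hCg)
    rw [← Real.exp_add, Real.exp_le_exp]
    nlinarith [l1_nonneg (y - u)]
  -- triangle: e^{-m|x-z|}·e^{-m|z-u|} ≤ e^{-m|x-u|}, and the symmetric one
  have t1 : Real.exp (-m * l1 (x - z)) * Real.exp (-m * l1 (z - u)) ≤ Real.exp (-m * l1 (x - u)) := by
    rw [← Real.exp_add, Real.exp_le_exp]; nlinarith [l1_sub_triangle x z u]
  have t2 : Real.exp (-m * l1 (x - z)) * Real.exp (-m * l1 (x - u)) ≤ Real.exp (-m * l1 (z - u)) := by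
    rw [← Real.exp_add, Real.exp_le_exp]
    have := l1_sub_triangle z x u
    rw [← OneStepKernelFamily.l1_neg_eq (z - x), neg_sub] at this
    nlinarith [l1_nonneg (x - u)]
  have eu : Real.exp (-min η δ * (l1 (x - u) + l1 (z - u))) = Real.exp (-m * l1 (x - u)) * Real.exp (-m * l1 (z - u)) := by
    rw [← Real.exp_add]; congr 1; rw [hm]; ring
  rw [eu]
  calc |M x z a b * (g z b - g x a)| = |M x z a b| * |g z b - g x a| := abs_mul _ _
    _ ≤ |M x z a b| * (|g z b| + |g x a|) := mul_le_mul_of_nonneg_left (abs_sub _ _) (abs_nonneg _)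
    _ ≤ (C * Real.exp (-m * l1 (x - z))) * (Cg * (Real.exp (-m * l1 (z - u)) * Real.exp (-m * l1 (z - u)))
          + Cg * (Real.exp (-m * l1 (x - u)) * Real.exp (-m * l1 (x - u)))) :=
        mul_le_mul h1 (add_le_add (h2 z b) (h2 x a)) (by positivity) (by positivity)
    _ = C * Cg * ((Real.exp (-m * l1 (x - z)) * Real.exp (-m * l1 (z - u))) * Real.exp (-m * l1 (z - u))
          + (Real.exp (-m * l1 (x - z)) * Real.exp (-m * l1 (x - u))) * Real.exp (-m * l1 (x - u))) := by ring
    _ ≤ C * Cg * (Real.exp (-m * l1 (x - u)) * Real.exp (-m * l1 (z - u)) + Real.exp (-m * l1 (z - u)) * Real.exp (-m * l1 (x - u))) := by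
        refine mul_le_mul_of_nonneg_left (add_le_add ?_ ?_) (by positivity)
        · exact mul_le_mul_of_nonneg_right t1 (Real.exp_pos _).le
        · exact mul_le_mul_of_nonneg_right t2 (Real.exp_pos _).le
    _ = 2 * C * Cg * (Real.exp (-m * l1 (x - u)) * Real.exp (-m * l1 (z - u))) := by ring

/-- [folklore] **THE R5′ SOCKET'S FIRST-ORDER LOCALISATION LETTER FOR CHART CONTACTS**: a family of diagonal generators bi-localised at their bonds gives a
`VertexFamily` of chart contacts at blocking `1`. -/
theorem vertexFamily_conjV_diagK {M : MKer (d + 1) (Fib d)} {g : Fin (d + 1) → (Fin (d + 1) → ℤ) → (Fin (d + 1) → ℤ) → Fib d → ℝ} {C Cg η δ : ℝ}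
    (hM : Decays M C η) (hη : 0 ≤ η) (hg : ∀ κ u, BiLoc (diagK (g κ u)) u u Cg δ) (hδ : 0 ≤ δ) :
    VertexFamily (fun κ u => conjV M (diagK (g κ u))) 1 (2 * C * Cg) (min η δ) := by
  intro κ u
  simpa using biLoc_conjV_diagK hM hη (hg κ u) hδ

end Summit.QuantumFields.BalabanUV.Beta.FP.ChartContactLetters

end
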